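import Summits.BirchSwinnertonDyer.Rank1Residual.Additive.RamifiedSevenGenusFactorisationShape
import Literature.NumberTheory.EllipticCurves.Kato2004.CMTwistedIwasawaModules
import Literature.NumberTheory.EllipticCurves.Kato2004.ZetaClassOnRankLeOneBranch
import HarnessLib

/-!
# `𝒞₇` genus road (crux `EllipticUnitValueSevenOfGZK`, K7r), block (B1b): the SHAPES of the Kato column —
# the value pin `IsNormedEllipticUnitFamily F θu` of the elliptic family, the KATO-SIDE FRAME `KatoGenusFrame` of a
# member `W` (Kato's (15.16.1)∘15.14 skeleton AT THE SPLIT HULL, with the dictionary pins (P0), LATTICE LEMMA, §5,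
# FRAME LEMMA made explicit fields), and crux K2ᶜ's weak form `ResidueIsGenusUnitClassShape` = F7's
# `Kato15161WeakShape` INSTANTIATED on that frame — structures and `Prop`-valued predicates; NOTHING asserted, NO named fact

Cell bsd-cm, seat bsd-cm-prr-ty1 g28 (literature-prover), row (GENUS-PORT-B) of the scope `SCOPE-GENUS-PORT-F8.md`
(16530c741a99cc96), SUMMON `wake/SUMMON-bsd-cm-prr-ty1-20260830T1110Z.md` (1c4b9c2558877aeb) incl. its 11:45Z ADDENDUM;
frozen proof-memo `MEMO-bsd-cm-genus` v1 (a38f3eedd2c92d58) §0 skeleton (d)–(f), §1 (N1)/(N6)–(N8), §2 (P0), §3 FRAME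
LEMMA (F3)–(F4), §4 LATTICE LEMMA (L3)–(L4) and LEMMA L, §5 «k = 2 COMPATIBILITY», §9 (G7′); row A's (B1a)
`RamifiedSevenGenusFactorisationShape.lean` (names FROZEN: `GenusFrame`, `GenusDatum F θu`, `GenusResidueNonzeroShape`).
HONEST LABEL: this file DEFINES; it proves no summit statement, closes no item, registers no stub (the CLOSED ∀/∃-forms
of K1ᵘ / K2ᶜ / (E2) are the pen's, in `Cruxes/EllipticUnitValueSevenOfGZK/Lines/kato_perrin_riou_zp.lean`; blocks
(B3)/(B4) of this row carry them only as HYPOTHESIS TYPES); stmt-BirchSwinnertonDyer-19945 is OPEN; `X12.CMRamifiedSeven`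
is NOT proved; BSD is claimed for no curve.

## The idiom (that of F7 `CMTwisted.Frame1516` / `Kato15161WeakShape` and of row A's `GenusFrame` / `GenusDatum`)

HYPOTHESIS STRUCTURES whose fields are PINS in existing vocabulary + `Prop`-valued PREDICATES; existence is NOT
asserted.  CONCRETE where the tree has the object: the cyclotomic side is the tree's pinned Iwasawa cohomology
`I : Kato2004.IwasawaH1Data W 7 K γ` (`I.H = 𝐇¹_Γ(T₇W)` on the `Δ`-trivial branch, memo (N7)/(P0)(i)), the admissible
classes are `Kato2004.IsAdmissibleZetaClass W 7 K hK I z₀`, and Kato's `Ω_W`-normalised class `𝐳_{γ_W}` is PINNED THROUGH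
THE TREE'S UNIFORM POSITION `Kato2004.ZetaClassPosition W 7 K hK I k z₁` («`z₁ = 7^k·𝐳_{γ_W}` uniformly w.r.t. every
value-pinned realised family», file `Kato2004/ZetaClassOnRankLeOneBranch.lean`).  ABSTRACT where the tree has no object
(HONEST LIMIT, as in F7): the coefficient ring `Λ_O = O_𝔭⟦Γ⟧`, the `K_𝔭`-linear Iwasawa cohomology `𝐇′(𝒱′)` of the
INDUCED representation with its split-hull lattice `𝐇′(S′_W)` (Kato 15.14 = Shapiro), the map (15.12.1)∘15.14 and the
transported elliptic-unit class `EU_𝔞`, the reduction mod `π` — all carried by F7's `Frame1516` on abstract carriers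
`(R, A)` plus the explicit pins below.  No `instance` is declared (the carriers' structures are structure fields
registered by `attribute [instance]`, as for `Kato2004.IwasawaH1Data` / `ChiEigenSelmerInDualData`); no notation.

## The objects

* **`IsNormedEllipticUnitFamily F θu`** (SUMMON ADDENDUM; memo (N8) «`θ_n := N_{K(7^{n+1}𝔣)/F′_n}(_𝔞z_{7^{n+1}𝔣})`»,
  (N6) «`𝔣 = 𝔭·(D)`», (N1) «`K = ℚ(√−7)`»): the VALUE PIN of row A's parameter `θu n ∈ E(K_n)` in F5/(T7) currency —
  there are an imaginary quadratic field `K` with `√−7 ∈ K`, an embedding `ι : K → ℂ`, an identification of algebraic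
  closures `e : K̄ → ℚ̄` (explicit binder; the tree's `K̄ = AlgebraicClosure K` and `ℚ̄ = AlgebraicClosure ℚ` are
  unrelated types), the conductor `𝔣` (PINNED by `N𝔣 = 7·D²` and `𝔣 ∣ (7D)`, which forces `𝔣 = 𝔭·(D)`, `𝔭² = (7)`), an
  admissible twist `𝔞` (`IsTwist 7 𝔣 𝔞`) of norm `F.normA`, and level representatives `z n` of Kato's `_𝔞z_{7^{n+1}𝔣}`
  (`IsKatoUnitRep 7 ι 𝔣 (n+1) 𝔞 (z n)`: `ι̂(z n)^{12} = Θ(1; 7^{n+1}𝔣, 𝔞)`, `z n ∈ K(7^{n+1}𝔣)`), such that `F′_n ⊆ e(K(7^{n+1}𝔣))`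
  and `θu n = ∏_{τ ∈ Gal(K(7^{n+1}𝔣)/K), τ|_{e⁻¹F′_n} = id} e(τ(z n))` — the relative NORM to `F′_n = ℚ(ζ_{7^{n+1}}, √D)`
  (written as a `finprod` over the stabiliser; `K ⊂ ℚ(ζ₇) ⊂ F′_n ⊂ K(7^{n+1}𝔣)`, memo (N4)/(N8)).  ORIENTATION: none needed
  (a norm; the choices of `ι`, `e`, `ζsys` only move `θu n` by `Gal(F′_n/ℚ)`-conjugation and twelfth roots of unity are
  absent since `z n` itself, not its twelfth power, is normed — the consumer (K1ᵘ's assembly, memo §6 (G4)) reads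
  `χ`-logarithms, insensitive to both).
* **`KatoGenusFrame W K hK I d`** over a member `W`, a cyclotomic datum `(K, hK, γ, I)` and a genus datum `d : GenusDatum F θu`
  of row A (memo §3–§5, §9; module docstring «The idiom»).  FIELDS = PINS: (N1)/(N6) the CM field `Kcm ∋ √−7` of degree 2,
  `𝔣` (pinned as above), the twist `𝔞` with `N𝔞 = F.normA`; (N4) `R = Λ_O` a commutative `Λ`-algebra with `π` and a unit
  `v` such that `7 = v·π²` (`v = −1`); (N7)/(L4) `A = 𝐇′(𝒱′)`, an `R`-module (and `Λ`-module through `R`) with NO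
  `π`-torsion; F7's skeleton `frame : Frame1516 R A` read AT THE SPLIT HULL `S′_W` of the member's lattice (memo (L3);
  (K2_S) is homothety-invariant, §4): `frame.HS = 𝐇′(S′_W)`, `frame.zeta = 𝐳_{γ′}` (Kato's zeta element of the Betti
  class `γ′ = (15.11.3)(e_B, 0)`, rescaled with `S′ ↦ S′_W`), `frame.x 𝔞 = x_𝔞`, `frame.EU 𝔞 = EU_𝔞 ∈ 𝐇′(S′_W)` (the
  (15.12.1)∘15.14-image of `(_𝔞z_{7^m𝔣})_m ⊗ e_B`); (P0)(i)/(L4) the coefficient extension `j : I.H → A` with image in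
  `𝐇′(S′_W)` (`𝐇′(T_W^O) = I.H ⊗ O_𝔭 ≤ 𝐇′(S′_W)`); (L3) LATTICE LEMMA `zW = u·π^a·zS`, `a ≤ 1`, `u ∈ R^×`
  (`zS = 𝐳_{γ_{S′_W}⁺}`, `zW = 𝐳_{γ_W}`); §5 `frame.zeta = t·zS` (`t = ½` on paper; only `t ∈ R` is consumed); the
  ★-PIN of `𝐳_{γ_W}`: a uniform-position witness `(zOne, k)` of `I` (`ZetaClassPosition W 7 K hK I k zOne`) with
  `j zOne = 7^k·zW`; and the FRAME-LEMMA PIN (memo §3 (F3)–(F4) + §8 (G6)(2) + §9 (G7′)(1)–(2)): if row A's genus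
  residue of `d` is non-zero (`GenusResidueNonzeroShape d`: `e_{η₁}θ^𝔞 ∉ 7·𝓤^{η₁}`) then `EU_𝔞 ∉ π·𝐇′(S′_W)` (on paper:
  `red(EU_𝔞)|_{F′_n} = 12·R_n ⊗ ē₋` with `R_n = e_{η₁}[θ_n] ≠ 0` for some `n`).  A HYPOTHESIS STRUCTURE; nothing asserted
  to exist.
* **`ResidueIsGenusUnitClassShape Φ`** :≡ `CMTwisted.Kato15161WeakShape 7 Φ.𝔣 Φ.frame` — crux K2ᶜ `ResidueIsGenusUnitClass`
  in its WEAK form «`EU_𝔟 ∈ Λ_O·𝐳_{γ′}` for every admissible twist `𝔟`» (memo §9 (W-K2ᶜ); card REV 12.1), F7's predicate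
  INSTANTIATED on the frame.  A predicate; nothing asserted.

## What the closed forms will say, and their logical strength (for the pen's D440 pass; numbers, not adjectives)

The pen's K2ᶜ stub is expected to read «for every `W ∈ 𝒞₇`, cyclotomic datum and genus datum `d`, `∃ Φ : KatoGenusFrame
W K hK I d, ResidueIsGenusUnitClassShape Φ`» (block (B3) consumes exactly this as a hypothesis type).  GIVEN THE PINS,
block (B3) proves by PURE ALGEBRA: `(∃ Φ, shape Φ) → GenusResidueNonzeroShape d → ∀ admissible z₀ ∈ I.H, z₀ ∉ 7·I.H`.
So the `∃`-form certifies the TRANSPORT «genus residue ≠ 0 ⟹ 7-primitivity of the admissible classes of `I`»; its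
intended witness is Kato's frame ((15.12.1)∘15.14 written out for `K = ℚ(√−7) ⊂ ℚ(ζ_{7^∞})` = K2ᶜ proper, rank 3, plus
the typing of (P0)/(15.14)/(F3)–(F4), all PRINT or PROVED-ON-PAPER in the memo); it is NOT vacuous (`EU_𝔞 ∉ π·HS` forces
`EU_𝔞 ≠ 0`, the weak form then forces `zS ≠ 0`, `π`-torsion-freeness forces `zW ≠ 0`, and the ★-pin ties `zW` to the
admissible classes of `I` through the tree's VALUE-PINNED position — a cooked `j`/`zW` cannot meet `j_zOne` unless it
respects Kato's values), and it is NOT the crux K2 reworded (it is conditional on the genus residue and silent when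
`GenusResidueNonzeroShape d` fails).  **(κ) CAVEAT OF RECORD (pen D884, verbatim for the D440/costume pass and the card):
the frame's ONLY tie between the cyclotomic datum `d` and the Kato side is the implication pin `EU_not_mem_of_residue`;
hence the `∃Φ`-form is ALSO inhabited by the DEGENERATE choice `EU := (a multiple of) zeta` AS SOON AS (K2_S)
«`𝐳_{γ′} ∉ π·𝐇′(S′)`» is known (take `frame.EU 𝔟 := frame.zeta`, `C = 1`; the pin then reads «genus residue `≠ 0` ⇒
`t·zS ∉ π·𝐇′(S′_W)`», which (K2_S) supplies) — i.e. modulo the pins the stub is NOT WEAKER than (K2_S) «≈ (K2_S) ∧ pins»;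
its INTENDED inhabitant is `EU :=` the transported `𝔞`-elliptic-unit class (the FRAME LEMMA gives the pin from (G6); K2ᶜ =
(15.16.1)-weak gives the shape), and a proof via `EU := zeta` presupposes (K2_S) itself, so it is no shortcut: content enters
through (15.16.1)-weak on the genuine `EU`.  A value pin of `frame.EU` in the shape of Kato 15.9/(15.12.2) would remove the
degenerate inhabitant; it needs Prop. 15.9 typed (not in the tree; the K2ᶜ row's named fact) and is left to that row
(pen D884 (λ)).**  The value pin makes the pen's K1ᵘ stub of record «`∀ (F : GenusFrame) (θu : ∀ n, globalUnitsOf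
(F.layer n)), IsNormedEllipticUnitFamily F θu → ∃ d : OrientedGenusDatum F θu, OrientedGenusFactorisationShape d`» (row A's
orientation re-cut, `RamifiedSevenGenusOrientedFactorisation.lean`, p773527; `OrientedGenusDatum F θu extends GenusDatum F θu`)
non-vacuous in `θu`; the residue predicate `GenusResidueNonzeroShape` and hence every binder `d : GenusDatum F θu` below are
orientation-free — the skeleton instantiates them at `d′.toGenusDatum`.

## References
Frozen memo `MEMO-bsd-cm-genus` v1 (a38f3eedd2c92d58) §0–§5, §8–§10; scope F8 (16530c741a99cc96); SUMMON 1c4b9c2558877aeb;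
K. Kato, Astérisque 295 (2004) §8.1 (8.1.3), Thm. 12.4–12.5, §13.9, §15.5–15.6, 15.10–15.11, (15.12.1), 15.14, (15.16.1)
[Kato2004Asterisque]; E. de Shalit, *Iwasawa theory of elliptic curves with complex multiplication* (1987) II.2, II.5
[deShalit1987]; row A (B1a)/(B2), F5 `KroneckerLimitFormula.lean`, F6 `CMInducedRepresentation.lean`, F7
`CMTwistedIwasawaModules.lean`, ★ `ZetaClassOnRankLeOneBranch.lean`, kernel blueprint `KatoGenusResidueSketch.lean`
(5a996a18d1327d07: `k2_transfer_of_split`, `k2_of_genusResidue_seven` — re-proved in block (B3), never imported).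
-/

noncomputable section

open scoped NumberField
open Literature.NumberTheory.EllipticCurves
open Literature.NumberTheory.EllipticCurves.IwasawaAlgebra
open Literature.NumberTheory.EllipticCurves.Kato2004
open Literature.NumberTheory.ComplexMultiplication.EllipticUnits

namespace Summit.BirchSwinnertonDyer.Rank1Residual.Additive.GenusSeven

/-! ## §1 The value pin of the elliptic family `θu` (SUMMON ADDENDUM): `θu n = N_{K(7^{n+1}𝔣)/F′_n}(_𝔞z_{7^{n+1}𝔣})` -/

/-- **`IsNormedEllipticUnitFamily F θu` — the global family `θu n ∈ E(F′_n)` IS the family of normed `𝔞`-elliptic units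
`θ_n = N_{K(7^{n+1}𝔣)/F′_n}(_𝔞z_{7^{n+1}𝔣})`** of memo (N8), for `K = ℚ(√−7)`, `𝔣 = 𝔭·(D)` (the conductor of `ψ_D`,
pinned by `N𝔣 = 7D²`, `𝔣 ∣ (7D)`) and an admissible twist `𝔞` of norm `F.normA`, in the currency of F5/(T7)
(`IsKatoUnitRep 7 ι 𝔣 (n+1) 𝔞 (z n)`: `z n ∈ K(7^{n+1}𝔣)` with `ι̂(z n)^{12} = Θ(1; 7^{n+1}𝔣, 𝔞)`); the identification
`e : K̄ → ℚ̄` of algebraic closures is an explicit binder, `F′_n ⊆ e(K(7^{n+1}𝔣))`, and the norm is the product over the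
stabiliser of `e⁻¹F′_n` in `Gal(K(7^{n+1}𝔣)/K)`.  A predicate; nothing asserted.
[cite: Kato2004Asterisque, §15.5 (p. 253, "_𝔞z_𝔣 ∈ K(𝔣)^×") and §15.14 (p. 264, "K ⊂ ℚ(ζ_{p^∞})")] [cite: deShalit1987, II.2.4 Proposition and II.2.5 (norm relations of the elliptic units)] -/
def IsNormedEllipticUnitFamily (F : GenusFrame) (θu : ∀ n : ℕ, globalUnitsOf (F.layer n)) : Prop :=
  ∃ (K : Type) (_ : Field K) (_ : NumberField K) (s : K) (ι : K →+* ℂ)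
    (e : AlgebraicClosure K →+* AlgebraicClosure ℚ) (𝔣 𝔞 : Ideal (𝓞 K)) (z : ℕ → (AlgebraicClosure K)ˣ)
    (hz : ∀ n : ℕ, IsKatoUnitRep 7 ι 𝔣 (n + 1) 𝔞 (z n)),
    Module.finrank ℚ K = 2 ∧ s ^ 2 = -7 ∧
    Ideal.absNorm 𝔣 = 7 * F.d ^ 2 ∧ 𝔣 ∣ Ideal.span {((7 * F.D : ℤ) : 𝓞 K)} ∧
    IsTwist 7 𝔣 𝔞 ∧ Ideal.absNorm 𝔞 = F.normA ∧
    (∀ (n : ℕ) (y : AlgebraicClosure ℚ), y ∈ F.layer n →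
      ∃ x : AlgebraicClosure K, x ∈ katoLayer 7 𝔣 (n + 1) ∧ e x = y) ∧
    ∀ n : ℕ, (((θu n : globalUnitsOf (F.layer n)) : (AlgebraicClosure ℚ)ˣ) : AlgebraicClosure ℚ) =
      ∏ᶠ τ ∈ {τ : katoLayer 7 𝔣 (n + 1) ≃ₐ[K] katoLayer 7 𝔣 (n + 1) |
          ∀ x : katoLayer 7 𝔣 (n + 1), e (x : AlgebraicClosure K) ∈ F.layer n → τ x = x},
        e ((τ ⟨((z n : (AlgebraicClosure K)ˣ) : AlgebraicClosure K), (hz n).1.1⟩ : katoLayer 7 𝔣 (n + 1)) :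
          AlgebraicClosure K)

/-! ## §2 The Kato-side frame of a member: (15.16.1)∘15.14 at the split hull, with the dictionary pins -/

/-- **The KATO-SIDE FRAME of a member `W`** over a cyclotomic datum `(K, hK, γ, I)` and a genus datum `d` of row A
(module docstring «The objects»): F7's `Frame1516` on abstract carriers `R = Λ_O`, `A = 𝐇′(𝒱′)` read at the split
hull `S′_W`, plus the pins (N1)/(N6) (CM field, `𝔣`, `𝔞`), (N4) (`7 = v·π²`), (L4) (no `π`-torsion; `j : I.H → 𝐇′(S′_W)`),
(L3) (`zW = u·π^a·zS`, `a ≤ 1`), §5 (`𝐳_{γ′} = t·zS`), the ★-pin of `𝐳_{γ_W}` through `ZetaClassPosition`, and the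
FRAME-LEMMA pin (genus residue `≠ 0` ⟹ `EU_𝔞 ∉ π·𝐇′(S′_W)`).  HYPOTHESIS STRUCTURE; nothing is asserted to exist.
[cite: Kato2004Asterisque, §15.11 (15.11.2)–(15.11.3) (pp. 260–262), (15.12.1) (p. 262), 15.14 (p. 264), (15.16.1) (p. 265), Thm. 12.4 (2) and Thm. 12.5 (1) (p. 221)] -/
structure KatoGenusFrame (W : WeierstrassCurve ℚ) [W.IsElliptic] [W.IsGloballyMinimal] [Fact (Nat.Prime 7)]
    [ContinuousSMul ℤ_[7] (W.tateModule 7)] (K : ZpExtension ℚ 7) (hK : K.IsCyclotomic)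
    {γ : Field.absoluteGaloisGroup ℚ} (I : IwasawaH1Data W 7 K γ)
    {F : GenusFrame} {θu : ∀ n : ℕ, globalUnitsOf (F.layer n)} (d : GenusDatum F θu) : Type 1 where
  /-- (N1) the CM field `K = ℚ(√−7)`: a number field of degree `2` containing a square root of `−7`. -/
  Kcm : Type
  [instField : Field Kcm]
  [instNumberField : NumberField Kcm]
  finrank_Kcm : Module.finrank ℚ Kcm = 2
  sqrtNegSeven : Kcm
  sqrtNegSeven_sq : sqrtNegSeven ^ 2 = -7
  /-- (N6) the conductor `𝔣 = 𝔭·(D)` of `ψ_D`, pinned by its norm `7D²` and `𝔣 ∣ (7D)`. -/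
  𝔣 : Ideal (𝓞 Kcm)
  absNorm_𝔣 : Ideal.absNorm 𝔣 = 7 * F.d ^ 2
  𝔣_dvd : 𝔣 ∣ Ideal.span {((7 * F.D : ℤ) : 𝓞 Kcm)}
  /-- (N8) the auxiliary admissible twist `𝔞` (prime to `6·7·𝔣`, `𝔞 ≠ O_K`) of norm `F.normA`. -/
  𝔞 : Ideal (𝓞 Kcm)
  isTwist_𝔞 : IsTwist 7 𝔣 𝔞
  absNorm_𝔞 : Ideal.absNorm 𝔞 = F.normA
  /-- (N4) the coefficient ring `R = Λ_O = O_𝔭⟦Γ⟧ = Λ ⊗_{ℤ₇} O_𝔭`, a commutative `Λ`-algebra. -/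
  R : Type
  [instCommRing : CommRing R]
  [instAlgebra : Algebra (IwasawaAlgebra 7) R]
  /-- The uniformiser `π = √−7` of `O_𝔭` (as an element of `Λ_O`) and the unit `v` with `7 = v·π²` (`v = −1`). -/
  π : R
  v : Rˣ
  seven_eq : (7 : R) = (v : R) * π ^ 2
  /-- (N7) `A = 𝐇′(𝒱′)`: the branch-`0` Iwasawa cohomology with `K_𝔭`-coefficients, an `R`-module (a `Λ`-module through `R`). -/
  A : Type
  [instAddCommGroup : AddCommGroup A]
  [instModule : Module R A]
  [instModuleΛ : Module (IwasawaAlgebra 7) A]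
  [instTower : IsScalarTower (IwasawaAlgebra 7) R A]
  /-- (L4) `𝐇′(𝒱′)` has no `π`-torsion (`H⁰(ℚ(ζ_{7^∞}), S′(1)/π) = 0`). -/
  torsionFree_π : ∀ x : A, π • x = 0 → x = 0
  /-- F7's (15.16.1)∘15.14 skeleton AT THE SPLIT HULL `S′_W`: `HS = 𝐇′(S′_W)`, `zeta = 𝐳_{γ′}`, `x 𝔟 = x_𝔟`, `EU 𝔟 = EU_𝔟`, `EU_mem`. -/
  frame : CMTwisted.Frame1516 (K := Kcm) R A
  /-- (P0)(i)/(L4) the coefficient extension `𝐇¹_Γ(T₇W) = I.H → I.H ⊗ O_𝔭 = 𝐇′(T_W^O) ≤ 𝐇′(S′_W) ≤ 𝐇′(𝒱′)`, `Λ`-linear. -/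
  j : I.H →ₗ[IwasawaAlgebra 7] A
  j_mem : ∀ z : I.H, j z ∈ frame.HS
  /-- (L3) `zS = 𝐳_{γ_{S′_W}⁺}`, Kato's zeta element of a generator of the plus-part of the split hull. -/
  zS : A
  /-- (L3) LATTICE LEMMA: `𝐳_{γ_W} = u·π^a·zS` with `u ∈ R^×` and `a ∈ {0, 1}` (the member sits at a non-split vertex). -/
  u : Rˣ
  a : ℕ
  a_le_one : a ≤ 1
  /-- §5 (k = 2 compatibility): `𝐳_{γ′} = t·zS`, `t ∈ R` (on paper `t = ½`, a `7`-unit; only integrality is consumed). -/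
  t : R
  zeta_eq : frame.zeta = t • zS
  /-- ★-pin of `𝐳_{γ_W}`: a uniform-position witness `(zOne, k)` of `I` — «`zOne = 7^k·𝐳_{γ_W}`» w.r.t. every value-pinned
  realised family (Kato Thm. 12.5 (1), §13.9) — and its image `j zOne = 7^k·(u·π^a·zS)`. -/
  zOne : I.H
  k : ℕ
  zOne_pos : ZetaClassPosition W 7 K hK I k zOne
  j_zOne : j zOne = ((7 : IwasawaAlgebra 7) ^ k) • ((u : R) • π ^ a • zS)
  /-- FRAME-LEMMA pin (memo (F3)–(F4), (G6)(2), (G7′)(1)–(2)): if the genus residue of `d` is non-zero then the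
  transported elliptic-unit class is not divisible by `π` in `𝐇′(S′_W)`. -/
  EU_not_mem_of_residue : GenusResidueNonzeroShape d → ¬ ∃ y ∈ frame.HS, frame.EU 𝔞 = π • y

attribute [instance] KatoGenusFrame.instField KatoGenusFrame.instNumberField KatoGenusFrame.instCommRing
  KatoGenusFrame.instAlgebra KatoGenusFrame.instAddCommGroup KatoGenusFrame.instModule KatoGenusFrame.instModuleΛ
  KatoGenusFrame.instTower

/-! ## §3 Crux K2ᶜ's weak form on the frame, and the frame's elementary API -/

section Frame

variable {W : WeierstrassCurve ℚ} [W.IsElliptic] [W.IsGloballyMinimal] [Fact (Nat.Prime 7)]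
  [ContinuousSMul ℤ_[7] (W.tateModule 7)] {K : ZpExtension ℚ 7} {hK : K.IsCyclotomic}
  {γ : Field.absoluteGaloisGroup ℚ} {I : IwasawaH1Data W 7 K γ}
  {F : GenusFrame} {θu : ∀ n : ℕ, globalUnitsOf (F.layer n)} {d : GenusDatum F θu}

/-- **`ResidueIsGenusUnitClassShape Φ` — crux K2ᶜ `ResidueIsGenusUnitClass`, WEAK form, on the frame**: F7's
`Kato15161WeakShape` («`EU_𝔟 ∈ Λ_O·𝐳_{γ′}` for every admissible twist `𝔟`», (15.16.1)∘15.14 with an INTEGRAL comparison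
constant) instantiated at `(p, 𝔣) = (7, Φ.𝔣)` on `Φ.frame`.  A predicate; nothing asserted.
[cite: Kato2004Asterisque, §15.16 (15.16.1) (p. 265) and Prop. 15.17, proof, last line (p. 265, "similarly by using 15.14")] -/
def ResidueIsGenusUnitClassShape (Φ : KatoGenusFrame W K hK I d) : Prop :=
  CMTwisted.Kato15161WeakShape (K := Φ.Kcm) 7 Φ.𝔣 Φ.frame

/-- Unfolding `ResidueIsGenusUnitClassShape`. [cite: Kato2004Asterisque, §15.16 (15.16.1) (p. 265)] -/
theorem residueIsGenusUnitClassShape_iff (Φ : KatoGenusFrame W K hK I d) :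
    ResidueIsGenusUnitClassShape Φ ↔
      ∀ 𝔟 : Ideal (𝓞 Φ.Kcm), IsTwist 7 Φ.𝔣 𝔟 → ∃ C : Φ.R, Φ.frame.EU 𝔟 = C • Φ.frame.zeta :=
  Iff.rfl

namespace KatoGenusFrame

variable (Φ : KatoGenusFrame W K hK I d)

/-- **`zW = 𝐳_{γ_W} = u·π^a·zS`** — Kato's `Ω_W`-normalised zeta class of the member in `𝐇′(𝒱′)` (memo (L3), (N7)).
[cite: Kato2004Asterisque, Thm. 12.5 (1) (p. 221)] -/
def zW : Φ.A := (Φ.u : Φ.R) • Φ.π ^ Φ.a • Φ.zS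

/-- Unfolding `zW`. [cite: Kato2004Asterisque, Thm. 12.5 (1) (p. 221)] -/
theorem zW_def : Φ.zW = (Φ.u : Φ.R) • Φ.π ^ Φ.a • Φ.zS := rfl

/-- The ★-pin read through `zW`: `j zOne = 7^k • zW`. [cite: Kato2004Asterisque, Thm. 12.5 (1) (p. 221), §13.9 (p. 230)] -/
theorem j_zOne_eq_pow_smul_zW : Φ.j Φ.zOne = ((7 : IwasawaAlgebra 7) ^ Φ.k) • Φ.zW := Φ.j_zOne

/-- `Λ` acts on `A = 𝐇′(𝒱′)` through `Λ_O`: `f • x = (algebraMap Λ Λ_O f) • x`. [cite: Kato2004Asterisque, 15.14 (p. 264, "⊗_{O_λ[[G′_∞]]} O_λ[[G_∞]]")] -/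
theorem iwasawa_smul_eq (f : IwasawaAlgebra 7) (x : Φ.A) : f • x = algebraMap (IwasawaAlgebra 7) Φ.R f • x :=
  (algebraMap_smul Φ.R f x).symm

/-- **`7` acts on `𝐇′(𝒱′)` as `v·π²`** (`7·O_𝔭 = π²·O_𝔭`, memo (N1)). [cite: Kato2004Asterisque, 15.14 (p. 264)] -/
theorem seven_smul_eq (x : Φ.A) : (7 : IwasawaAlgebra 7) • x = ((Φ.v : Φ.R) * Φ.π ^ 2) • x := by
  rw [Φ.iwasawa_smul_eq, map_ofNat, Φ.seven_eq]

/-- `𝐇′(𝒱′)` has no `π^n`-torsion. [cite: Kato2004Asterisque, Thm. 12.4 (2) (p. 221, "torsion free")] -/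
theorem torsionFree_π_pow (n : ℕ) (x : Φ.A) (h : Φ.π ^ n • x = 0) : x = 0 := by
  induction n generalizing x with
  | zero => simpa using h
  | succ n ih =>
    rw [pow_succ', mul_smul] at h
    exact ih x (Φ.torsionFree_π _ h)

/-- `𝐇′(𝒱′)` has no `7^n`-torsion (`7^n = v^n·π^{2n}`). [cite: Kato2004Asterisque, Thm. 12.4 (2) (p. 221, "torsion free")] -/
theorem torsionFree_seven_pow (n : ℕ) (x : Φ.A) (h : ((7 : IwasawaAlgebra 7) ^ n) • x = 0) : x = 0 := by
  rw [Φ.iwasawa_smul_eq, map_pow, map_ofNat, Φ.seven_eq, mul_pow, ← pow_mul, mul_smul, ← Units.val_pow_eq_pow_val,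
    ← Units.smul_def, smul_eq_zero_iff_eq] at h
  exact Φ.torsionFree_π_pow _ x h

/-- `j` carries the `Λ`-divisibility currency of the crux into `𝐇′(S′_W)`: `j (7 • y) = (v·π²) • j y`.
[cite: Kato2004Asterisque, 15.14 (p. 264)] -/
theorem j_seven_smul (y : I.H) : Φ.j ((7 : IwasawaAlgebra 7) • y) = ((Φ.v : Φ.R) * Φ.π ^ 2) • Φ.j y := by
  rw [map_smul, Φ.seven_smul_eq]

/-- **(G7′)(3) on the frame**: under the weak form K2ᶜ and a non-zero genus residue of `d`, the split-vertex class is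
`π`-indivisible in `𝐇′(S′_W)` — statement (K2_S) of memo §4, the hypothesis `hS` of LEMMA L («if `zS = π·h` then
`EU_𝔞 = C·t·π·h ∈ π·𝐇′(S′_W)`»).  F7's `not_exists_eq_smul_of_weakShape` with `red` replaced by non-membership.
[cite: Kato2004Asterisque, §15.16 (15.16.1) (p. 265) with Thm. 12.4 (2) (p. 221)] -/
theorem zS_ne_pi_smul (hshape : ResidueIsGenusUnitClassShape Φ) (hres : GenusResidueNonzeroShape d) :
    ∀ h ∈ Φ.frame.HS, Φ.zS ≠ Φ.π • h := by
  intro h hh hzS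
  obtain ⟨C, hC⟩ := hshape Φ.𝔞 Φ.isTwist_𝔞
  refine Φ.EU_not_mem_of_residue hres ⟨(C * Φ.t) • h, Φ.frame.HS.smul_mem _ hh, ?_⟩
  rw [hC, Φ.zeta_eq, hzS, smul_smul, smul_comm]

end KatoGenusFrame

end Frame

end Summit.BirchSwinnertonDyer.Rank1Residual.Additive.GenusSeven

end
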